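import Mathlib
import HarnessLib
import Literature.Probability.ODonnellSaksSchrammServedio2005.DecisionTreeCovariance

/-!
# Decision trees that `L²`-approximate a function force an influential variable
# (the OSSS half of PROPOSITION C, end to end in kernel)

Solo seat `solo-QuantumAdvantage-informed`, session 17, file 38 (§4.33 (2) of the seat's paper,
direction (iii) ⟹ (i) of PROPOSITION C: "`poly(d, 1/ε)`-depth classical `L²`-simulation of every
bounded degree-`d` polynomial ⟹ the Aaronson–Ambainis conjecture").

THE STATEMENT. Let `T` be a reduced deterministic decision tree on `{0,1}ⁿ` with leaf labels in
`[−1, 1]`, of depth `D`, and let `g : {0,1}ⁿ → ℝ` be any function with mean `μ` and variance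
`Var g = E (g − μ)²`. If `T` approximates `g` in mean square to within a quarter of the variance,
`E (g − T)² ≤ Var g / 4`, then

* `Var g ≤ 2 · D · max_j E|D_j g|`                                  (`var_le_two_depth_mul`),
* some variable has `E|D_j g| ≥ Var g / (2D)` (when `D > 0`)         (`exists_influential_of_approx`),
* `(Var g)² ≤ 4 · D² · max_j E (D_j g)²`, i.e. some `L²`-influence is `≥ (Var g)² / (4D²)`
                                                                     (`var_sq_le_of_sq_influence`),

where `D_j g (x) = (g(x^{j→1}) − g(x^{j→0}))/2`. Everything is in finite-sum form over the cube
(uniform measure = normalised counting), matching the Literature file it rests on.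

PROOF. `Cov[T, g] = E[(T − μ)(g − μ)] = Var g − E[(g − T)(g − μ)] ≥ Var g − ‖g − T‖₂ ‖g − μ‖₂ ≥ Var g / 2`
(Cauchy–Schwarz), and `Cov[T, g] ≤ Σ_j δ_j(T) E|D_j g| ≤ D · max_j E|D_j g|` is the two-function OSSS
inequality, FULLY PROVED in `Literature.Probability.ODonnellSaksSchrammServedio2005.DecisionTreeCovariance`
(`DTree.osss_cov`, O'Donnell–Saks–Schramm–Servedio 2005, Thm 3.2 "alternate version", p. 8); the
`L²` form is one more Cauchy–Schwarz `(E|D_j g|)² ≤ E (D_j g)²`. Trust base: Mathlib only (no named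
facts): the Literature file is itself sorry- and hypothesis-free.

USE. With `g := p` a bounded degree-`d` polynomial restricted to the cube and `T` a classical simulator
of depth `D = π(d, 1/ε)` achieving `E (p − T)² ≤ Var p / 4`, the third statement is
`max_j Inf_j(p) ≥ (Var p)² / (4 π(d,1/ε)²)` — the Aaronson–Ambainis conjecture (AA09 Conj. 6 /
Bhattacharya Conj. 1.3) with that polynomial; this is the kernel form of PROPOSITION C (iii) ⟹ (i).
Route from here to the summit `BQP ⊄ BPP`: none (the log-AA line calibrates how thin a separating
language must be; it is not a door) — recorded as such in the seat's PLAN.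
-/

namespace Summit.QuantumAdvantage.QuantumAdvantage.Theorems

namespace ApproximationInfluence

open Finset Literature.Probability.ODonnellSaksSchrammServedio2005
open Literature.Probability.ODonnellSaksSchrammServedio2005.DTree

variable {n : ℕ}

/-- Cauchy–Schwarz step: if `4 Σ (g − f)² ≤ V := Σ (g − μ)²` then `Σ (f − μ)(g − μ) ≥ V / 2`
(for any centre `μ`). -/
theorem half_var_le_sum_centered_mul (f g : Cube n → ℝ) (μ : ℝ)
    (happrox : 4 * ∑ y, (g y - f y) ^ 2 ≤ ∑ y, (g y - μ) ^ 2) :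
    (∑ y, (g y - μ) ^ 2) / 2 ≤ ∑ y, (f y - μ) * (g y - μ) := by
  have hV0 : 0 ≤ ∑ y, (g y - μ) ^ 2 := sum_nonneg fun _ _ => sq_nonneg _
  have hcs : (∑ y, (g y - f y) * (g y - μ)) ^ 2
      ≤ (∑ y, (g y - f y) ^ 2) * ∑ y, (g y - μ) ^ 2 :=
    Finset.sum_mul_sq_le_sq_mul_sq _ _ _
  have ha : (∑ y, (g y - f y) * (g y - μ)) ^ 2 ≤ ((∑ y, (g y - μ) ^ 2) / 2) ^ 2 := by
    calc (∑ y, (g y - f y) * (g y - μ)) ^ 2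
        ≤ (∑ y, (g y - f y) ^ 2) * ∑ y, (g y - μ) ^ 2 := hcs
      _ ≤ ((∑ y, (g y - μ) ^ 2) / 4) * ∑ y, (g y - μ) ^ 2 :=
          mul_le_mul_of_nonneg_right (by linarith) hV0
      _ = ((∑ y, (g y - μ) ^ 2) / 2) ^ 2 := by ring
  have ha' : ∑ y, (g y - f y) * (g y - μ) ≤ (∑ y, (g y - μ) ^ 2) / 2 :=
    (abs_le_of_sq_le_sq' ha (by linarith)).2
  have hid : ∑ y, (f y - μ) * (g y - μ)
      = (∑ y, (g y - μ) ^ 2) - ∑ y, (g y - f y) * (g y - μ) := by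
    rw [← Finset.sum_sub_distrib]
    exact sum_congr rfl fun y _ => by ring
  rw [hid]
  linarith

/-- The covariance in sum form equals `N · Σ (f − μ)(g − μ)` with `μ` the mean of `g`. -/
theorem cov_sum_eq (f g : Cube n → ℝ) :
    (Fintype.card (Cube n) : ℝ)
        * ∑ y, (f y - (∑ z, g z) / (Fintype.card (Cube n) : ℝ))
          * (g y - (∑ z, g z) / (Fintype.card (Cube n) : ℝ))
      = (Fintype.card (Cube n) : ℝ) * ∑ y, f y * g y - (∑ y, f y) * ∑ y, g y := by
  have hN : (Fintype.card (Cube n) : ℝ) ≠ 0 := by exact_mod_cast Fintype.card_ne_zero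
  have hterm : ∀ y, (f y - (∑ z, g z) / (Fintype.card (Cube n) : ℝ))
        * (g y - (∑ z, g z) / (Fintype.card (Cube n) : ℝ))
      = f y * g y - ((∑ z, g z) / (Fintype.card (Cube n) : ℝ)) * (f y + g y)
        + ((∑ z, g z) / (Fintype.card (Cube n) : ℝ)) ^ 2 := fun y => by ring
  have h : ∑ y, (f y - (∑ z, g z) / (Fintype.card (Cube n) : ℝ))
        * (g y - (∑ z, g z) / (Fintype.card (Cube n) : ℝ))
      = ∑ y, f y * g y - ((∑ z, g z) / (Fintype.card (Cube n) : ℝ)) * ((∑ y, f y) + ∑ y, g y)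
        + (Fintype.card (Cube n) : ℝ) * ((∑ z, g z) / (Fintype.card (Cube n) : ℝ)) ^ 2 := by
    rw [Finset.sum_congr rfl fun y _ => hterm y, Finset.sum_add_distrib, Finset.sum_sub_distrib,
      ← Finset.mul_sum, Finset.sum_add_distrib, Finset.sum_const, Finset.card_univ, nsmul_eq_mul]
  rw [h]
  have e : (Fintype.card (Cube n) : ℝ) * ((∑ z, g z) / (Fintype.card (Cube n) : ℝ)) = ∑ z, g z := by
    field_simp
  calc (Fintype.card (Cube n) : ℝ)
        * (∑ y, f y * g y - ((∑ z, g z) / (Fintype.card (Cube n) : ℝ)) * ((∑ y, f y) + ∑ y, g y)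
          + (Fintype.card (Cube n) : ℝ) * ((∑ z, g z) / (Fintype.card (Cube n) : ℝ)) ^ 2)
      = (Fintype.card (Cube n) : ℝ) * ∑ y, f y * g y
        - ((Fintype.card (Cube n) : ℝ) * ((∑ z, g z) / (Fintype.card (Cube n) : ℝ)))
          * ((∑ y, f y) + ∑ y, g y)
        + ((Fintype.card (Cube n) : ℝ) * ((∑ z, g z) / (Fintype.card (Cube n) : ℝ))) ^ 2 := by ring
    _ = (Fintype.card (Cube n) : ℝ) * ∑ y, f y * g y - (∑ z, g z) * ((∑ y, f y) + ∑ y, g y)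
        + (∑ z, g z) ^ 2 := by rw [e]
    _ = (Fintype.card (Cube n) : ℝ) * ∑ y, f y * g y - (∑ y, f y) * ∑ y, g y := by ring

/-- `L¹` influences in sum form are nonnegative. -/
theorem sum_abs_deriv_nonneg (j : Fin n) (g : Cube n → ℝ) : 0 ≤ ∑ z, |deriv j g z| :=
  sum_nonneg fun _ _ => abs_nonneg _

/-- THE `L²`-APPROXIMATION ⟹ INFLUENCE THEOREM (max form). If a reduced tree `T` with labels in
`[−1,1]` satisfies `E (g − T)² ≤ Var g / 4` and every `L¹` influence `E|D_j g|` is at most `M ≥ 0`,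
then `Var g ≤ 2 · depth(T) · M`. -/
theorem var_le_two_depth_mul (T : DTree n) (hT : T.Reduced) (hb : ∀ y, |T.eval y| ≤ 1)
    (g : Cube n → ℝ) {M : ℝ} (hM0 : 0 ≤ M)
    (hM : ∀ j, ∑ z, |deriv j g z| ≤ (Fintype.card (Cube n) : ℝ) * M)
    (happrox : 4 * ∑ y, (g y - T.eval y) ^ 2
      ≤ ∑ y, (g y - (∑ z, g z) / (Fintype.card (Cube n) : ℝ)) ^ 2) :
    (∑ y, (g y - (∑ z, g z) / (Fintype.card (Cube n) : ℝ)) ^ 2) / (Fintype.card (Cube n) : ℝ)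
      ≤ 2 * (T.depth : ℝ) * M := by
  have hN : 0 < (Fintype.card (Cube n) : ℝ) := by exact_mod_cast Fintype.card_pos
  have h1 := half_var_le_sum_centered_mul T.eval g ((∑ z, g z) / (Fintype.card (Cube n) : ℝ)) happrox
  have key := osss_cov T hT hb g
  have hq : ∑ j, T.qprob j * ∑ z, |deriv j g z|
      ≤ (Fintype.card (Cube n) : ℝ) * M * T.depth := by
    calc ∑ j, T.qprob j * ∑ z, |deriv j g z|
        ≤ ∑ j, T.qprob j * ((Fintype.card (Cube n) : ℝ) * M) :=
          Finset.sum_le_sum fun j _ => mul_le_mul_of_nonneg_left (hM j) (qprob_nonneg T j)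
      _ = ((Fintype.card (Cube n) : ℝ) * M) * ∑ j, T.qprob j := by rw [← Finset.sum_mul]; ring
      _ ≤ ((Fintype.card (Cube n) : ℝ) * M) * T.depth :=
          mul_le_mul_of_nonneg_left (sum_qprob_le_depth T) (by positivity)
  have hmain : (Fintype.card (Cube n) : ℝ)
      * ((∑ y, (g y - (∑ z, g z) / (Fintype.card (Cube n) : ℝ)) ^ 2) / 2)
      ≤ (Fintype.card (Cube n) : ℝ) * ((Fintype.card (Cube n) : ℝ) * M * T.depth) := by
    calc (Fintype.card (Cube n) : ℝ)
          * ((∑ y, (g y - (∑ z, g z) / (Fintype.card (Cube n) : ℝ)) ^ 2) / 2)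
        ≤ (Fintype.card (Cube n) : ℝ)
          * ∑ y, (T.eval y - (∑ z, g z) / (Fintype.card (Cube n) : ℝ))
            * (g y - (∑ z, g z) / (Fintype.card (Cube n) : ℝ)) :=
          mul_le_mul_of_nonneg_left h1 hN.le
      _ = (Fintype.card (Cube n) : ℝ) * ∑ y, T.eval y * g y - (∑ y, T.eval y) * ∑ y, g y :=
          cov_sum_eq _ _
      _ ≤ (Fintype.card (Cube n) : ℝ) * ∑ j, T.qprob j * ∑ z, |deriv j g z| := key
      _ ≤ (Fintype.card (Cube n) : ℝ) * ((Fintype.card (Cube n) : ℝ) * M * T.depth) :=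
          mul_le_mul_of_nonneg_left hq hN.le
  have h2 := le_of_mul_le_mul_left hmain hN
  rw [div_le_iff₀ hN]
  linarith

/-- Existential form: a tree of POSITIVE depth `D` that `L²`-approximates `g` to within `Var g / 4`
exhibits a variable with `E|D_j g| ≥ Var g / (2D)`. -/
theorem exists_influential_of_approx (T : DTree n) (hT : T.Reduced) (hb : ∀ y, |T.eval y| ≤ 1)
    (g : Cube n → ℝ) (hD : 0 < T.depth)
    (happrox : 4 * ∑ y, (g y - T.eval y) ^ 2
      ≤ ∑ y, (g y - (∑ z, g z) / (Fintype.card (Cube n) : ℝ)) ^ 2) :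
    ∃ j : Fin n,
      (∑ y, (g y - (∑ z, g z) / (Fintype.card (Cube n) : ℝ)) ^ 2) / (Fintype.card (Cube n) : ℝ)
          / (2 * (T.depth : ℝ))
        ≤ (∑ z, |deriv j g z|) / (Fintype.card (Cube n) : ℝ) := by
  have hN : 0 < (Fintype.card (Cube n) : ℝ) := by exact_mod_cast Fintype.card_pos
  have hne : (Finset.univ : Finset (Fin n)).Nonempty := by
    cases T with
    | leaf v => simp [DTree.depth] at hD
    | node i t₀ t₁ => exact ⟨i, Finset.mem_univ _⟩
  obtain ⟨j, -, hj⟩ := Finset.exists_max_image Finset.univ (fun j => ∑ z, |deriv j g z|) hne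
  refine ⟨j, ?_⟩
  have hM0 : 0 ≤ (∑ z, |deriv j g z|) / (Fintype.card (Cube n) : ℝ) :=
    div_nonneg (sum_abs_deriv_nonneg j g) hN.le
  have hcancel : (Fintype.card (Cube n) : ℝ) * ((∑ z, |deriv j g z|) / (Fintype.card (Cube n) : ℝ))
      = ∑ z, |deriv j g z| := by
    field_simp
  have hM : ∀ k, ∑ z, |deriv k g z|
      ≤ (Fintype.card (Cube n) : ℝ) * ((∑ z, |deriv j g z|) / (Fintype.card (Cube n) : ℝ)) := by
    intro k
    rw [hcancel]
    exact hj k (Finset.mem_univ k)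
  have h := var_le_two_depth_mul T hT hb g hM0 hM happrox
  have hD' : (0 : ℝ) < 2 * (T.depth : ℝ) := by positivity
  rw [div_le_iff₀ hD']
  linarith

/-- Cauchy–Schwarz on the cube: `(Σ |d|)² ≤ N · Σ d²`. -/
theorem sq_sum_abs_le (d : Cube n → ℝ) :
    (∑ z, |d z|) ^ 2 ≤ (Fintype.card (Cube n) : ℝ) * ∑ z, d z ^ 2 := by
  calc (∑ z, |d z|) ^ 2 = (∑ z, |d z| * 1) ^ 2 := by simp
    _ ≤ (∑ z, |d z| ^ 2) * ∑ _z : Cube n, (1 : ℝ) ^ 2 := Finset.sum_mul_sq_le_sq_mul_sq _ _ _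
    _ = (Fintype.card (Cube n) : ℝ) * ∑ z, d z ^ 2 := by
        simp only [one_pow, Finset.sum_const, Finset.card_univ, nsmul_eq_mul, mul_one, sq_abs]
        ring

/-- THE `L²`-INFLUENCE FORM. If a reduced tree `T` with labels in `[−1,1]` and depth `D` satisfies
`E (g − T)² ≤ Var g / 4` and every `L²` influence `E (D_j g)²` is at most `I ≥ 0`, then
`(Var g)² ≤ 4 · D² · I` — some variable has `L²`-influence at least `(Var g)² / (4 D²)`. With `g` a
bounded degree-`d` polynomial and `D = poly(d, 1/ε)` this is the Aaronson–Ambainis conjecture for `g`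
(PROPOSITION C (iii) ⟹ (i) of the seat's paper). -/
theorem var_sq_le_of_sq_influence (T : DTree n) (hT : T.Reduced) (hb : ∀ y, |T.eval y| ≤ 1)
    (g : Cube n → ℝ) {I : ℝ} (hI0 : 0 ≤ I)
    (hI : ∀ j, ∑ z, (deriv j g z) ^ 2 ≤ (Fintype.card (Cube n) : ℝ) * I)
    (happrox : 4 * ∑ y, (g y - T.eval y) ^ 2
      ≤ ∑ y, (g y - (∑ z, g z) / (Fintype.card (Cube n) : ℝ)) ^ 2) :
    ((∑ y, (g y - (∑ z, g z) / (Fintype.card (Cube n) : ℝ)) ^ 2) / (Fintype.card (Cube n) : ℝ)) ^ 2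
      ≤ 4 * (T.depth : ℝ) ^ 2 * I := by
  have hN : 0 < (Fintype.card (Cube n) : ℝ) := by exact_mod_cast Fintype.card_pos
  have hM : ∀ j, ∑ z, |deriv j g z| ≤ (Fintype.card (Cube n) : ℝ) * Real.sqrt I := by
    intro j
    have h2 : (∑ z, |deriv j g z|) ^ 2 ≤ ((Fintype.card (Cube n) : ℝ) * Real.sqrt I) ^ 2 := by
      calc (∑ z, |deriv j g z|) ^ 2 ≤ (Fintype.card (Cube n) : ℝ) * ∑ z, (deriv j g z) ^ 2 :=
            sq_sum_abs_le _
        _ ≤ (Fintype.card (Cube n) : ℝ) * ((Fintype.card (Cube n) : ℝ) * I) :=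
            mul_le_mul_of_nonneg_left (hI j) hN.le
        _ = ((Fintype.card (Cube n) : ℝ) * Real.sqrt I) ^ 2 := by
            rw [mul_pow, Real.sq_sqrt hI0]; ring
    exact (abs_le_of_sq_le_sq' h2 (by positivity)).2
  have h := var_le_two_depth_mul T hT hb g (Real.sqrt_nonneg I) hM happrox
  have hV0 : 0 ≤ (∑ y, (g y - (∑ z, g z) / (Fintype.card (Cube n) : ℝ)) ^ 2)
      / (Fintype.card (Cube n) : ℝ) :=
    div_nonneg (sum_nonneg fun _ _ => sq_nonneg _) hN.le
  calc ((∑ y, (g y - (∑ z, g z) / (Fintype.card (Cube n) : ℝ)) ^ 2) / (Fintype.card (Cube n) : ℝ)) ^ 2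
      ≤ (2 * (T.depth : ℝ) * Real.sqrt I) ^ 2 := pow_le_pow_left₀ hV0 h 2
    _ = 4 * (T.depth : ℝ) ^ 2 * I := by
        rw [mul_pow, mul_pow, Real.sq_sqrt hI0]; ring

end ApproximationInfluence

end Summit.QuantumAdvantage.QuantumAdvantage.Theorems
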